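import Literature.NumberTheory.EllipticCurves.FormalGroup
import Literature.NumberTheory.EllipticCurves.GlobalMinimalModel
import Literature.NumberTheory.EllipticCurves.Tamagawa
import HarnessLib

/-!
# The Mazur–Tate `p`-adic sigma function and the `p`-adic Eisenstein value `E₂(E, ω)`

Trunk T-NT-EC (Literature/NumberTheory/EllipticCurves); definition request `defn-padicE2`
(prerequisite, with `FormalGroup.lean`, of `defn-cyclotomicPAdicHeight`, route BirchSwinnertonDyer).

For an elliptic curve `E/ℚ` with good ORDINARY reduction at `p ≥ 5`, given by a (`p`-integral)
Weierstrass equation with invariant differential `ω = dx/(2y + a₁x + a₃)` and formal expansion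
`x(t) = t⁻² - a₁ t⁻¹ - ⋯ ∈ ℤ_p((t))`, `t = -x/y`:

**Mazur–Stein–Tate 2006, Thm. 1.3 (= Mazur–Tate 1991).** There is exactly one ODD function
`σ(t) = t + ⋯ ∈ t ℤ_p⟦t⟧` and constant `c ∈ ℤ_p` that together satisfy
`x(t) + c = -(d/ω)((1/σ)(dσ/ω))`. Moreover (MST 2006, §1, eq. for `c`; Katz 1973, App. 2)
`c = (a₁² + 4a₂)/12 - E₂(E, ω)/12`, where `E₂(E, ω)` is the value of Katz's `p`-adic weight-2
Eisenstein series at `(E, ω)` (defined by Katz through the unit-root splitting of `H¹_dR`).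

Since Lean has no `H¹_dR` with Frobenius, we DEFINE `E₂(E, ω)` through this theorem:

* `formalNeg W = [-1](t) = -t/(1 - a₁t - a₃w(t)) = -t - a₁t² - ⋯` (the formal inverse law,
  AEC IV.1) and `IsFormallyOdd W σ : σ([-1](t)) = -σ(t)` ("odd" in the Mazur–Tate sense,
  Harvey 2008, §4);
* `SatisfiesSigmaODE W σ c` — the differential equation with poles cleared (see its docstring);
* `IsMazurTateSigmaPair W σ c` — `σ = t + ⋯`, coefficients and `c` in `ℤ_p`, odd, ODE;
* `padicSigma W`, `padicSigmaConst W` — THE pair, by choice (junk `(t, 0)` if none exists;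
  well defined exactly when the pair is unique, i.e. under `mazur_tate_sigma_existsUnique`);
* `padicE2Local W = a₁² + 4a₂ - 12c` (junk `0` if no pair exists) for `W/ℚ_p`, and
  `padicE2 W p = padicE2Local (W ⊗ ℚ_p)` for `W/ℚ` (intended for globally minimal `W`, `p ≥ 5`
  good ordinary).
* Named fact `mazur_tate_sigma_existsUnique` (MST 2006 Thm. 1.3), stated for globally minimal
  `W/ℚ`, `p ≥ 5` of good ordinary reduction (`p ∤ a_p`). Nothing is asserted.

## Sources

* B. Mazur, W. Stein, J. Tate, *Computation of `p`-adic heights and log convergence*,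
  Doc. Math. Extra Vol. Coates (2006) 577–614, §1 (Thm. 1.3, eqs. for `℘(t)`, `c`), §3.1.
* B. Mazur, J. Tate, *The `p`-adic sigma function*, Duke Math. J. 62 (1991) 663–688, Thm. 3.1.
* D. Harvey, *Efficient computation of `p`-adic heights*, LMS J. Comput. Math. 11 (2008)
  (arXiv:0708.3404), §2.1 eq. (2), §4 (oddness `σ(i(t)) = -σ(t)`, `i` the formal inverse).
* N. M. Katz, *`p`-adic properties of modular schemes and modular forms*, LNM 350 (1973), App. 2.
* J. H. Silverman, *AEC*, IV.1 (formal inverse `i(T)`).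

## Design notes

* Clearing poles in the ODE. Write `σ = t·s(t)` (`s(0) = 1`), `D = d/ω = ω(t)⁻¹ d/dt`. Then
  `(1/σ)(dσ/ω) = σ'/(ωσ) = g/t` with `g := (s + t s')·(ω s)⁻¹ ∈ A⟦t⟧`, and
  `D(g/t) = (t g' - g)/(ω t²)`. So the ODE `x + c = -D(g/t)` is equivalent (in `ℚ_p((t))`, a
  domain, after multiplying by the unit `ω t²`... precisely by `ω` and the non-zero-divisor `t²`)
  to the POWER-SERIES identity `ω · (t²x(t) + c t²) = g - t g'`, which is `SatisfiesSigmaODE`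
  (`t² x(t) = formalXMulSq`, `ω = formalOmega` from `FormalGroup.lean`).
* `E₂` so defined agrees with Katz's by MST (1.3)–(1.5) whenever the Mazur–Tate pair exists
  uniquely; the weight-2 scaling `E₂(E, λω) = λ⁻² E₂(E, ω)` is not stated (it needs the change of
  Weierstrass model, left to the consumer).
-/

noncomputable section

open PowerSeries

namespace WeierstrassCurve

variable {R : Type*} [CommRing R] (W : WeierstrassCurve R)

/-! ### The formal inverse and oddness -/

/-- **The formal inverse law** `i(t) = [-1](t) = z(-P)`: since `-(x, y) = (x, -y - a₁x - a₃)`,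
`i(t) = x/(y + a₁x + a₃) = -t/(1 - a₁t - a₃w(t)) = -t - a₁t² - ⋯ ∈ R⟦t⟧`.
[Silverman AEC IV.1 (`i(T)`), Harvey 2008 §4] [cite: SilvermanAEC2009, IV.1.1] -/
def formalNeg : R⟦X⟧ :=
  -(X * PowerSeries.invOfUnit (1 - C W.a₁ * X - C W.a₃ * W.formalW) 1)

/-- **Oddness in the Mazur–Tate sense**: `σ(i(t)) = -σ(t)`, `i` the formal inverse law.
[Harvey 2008, §4 ("This condition means that `σ_p(i(t)) = -σ_p(t)`"); Mazur–Tate 1991, §3] [cite: Harvey2008, §4] -/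
def IsFormallyOdd (σ : R⟦X⟧) : Prop :=
  σ.subst W.formalNeg = -σ

/-! ### The Mazur–Tate differential equation (over a `ℚ`-algebra) -/

section RatAlgebra

variable {A : Type*} [CommRing A] [Algebra ℚ A] (W : WeierstrassCurve A)

/-- **The sigma ODE `x(t) + c = -(d/ω)((1/σ)(dσ/ω))`, poles cleared**: with `σ = t·s`,
`g = (s + t s')(ω s)⁻¹` (`= t σ'/(ω σ)`), the equation reads `ω · (t²x + c t²) = g - t g'` in
`A⟦t⟧` (module doc). [Mazur–Stein–Tate 2006, Thm. 1.3 (displayed ODE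
`x(t) + c = -d/ω(σ⁻¹ dσ/ω)`); Harvey 2008, §2.1 eq. (2)] [cite: MazurSteinTate2006, Thm. 1.3] -/
def SatisfiesSigmaODE (σ : A⟦X⟧) (c : A) : Prop :=
  let s : A⟦X⟧ := PowerSeries.mk fun n => coeff (n + 1) σ
  let g : A⟦X⟧ := (s + X * d⁄dX A s) * PowerSeries.invOfUnit (W.formalOmega * s) 1
  W.formalOmega * (W.formalXMulSq + C c * X ^ 2) = g - X * d⁄dX A g

end RatAlgebra

/-! ### Over `ℚ_p`: the Mazur–Tate pair, `σ_p`, `c`, `E₂` -/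

section Padic

open scoped Classical

variable {p : ℕ} [Fact p.Prime] (W : WeierstrassCurve ℚ_[p])

/-- **A Mazur–Tate sigma pair** `(σ, c)` for `W/ℚ_p`: `σ(t) = t + ⋯ ∈ tℤ_p⟦t⟧` (no constant
term, linear coefficient `1`, all coefficients in `ℤ_p`), `c ∈ ℤ_p`, `σ` odd, and the sigma ODE
holds. [Mazur–Stein–Tate 2006, Thm. 1.3; Mazur–Tate 1991, Thm. 3.1] [cite: MazurSteinTate2006, Thm. 1.3] -/
structure IsMazurTateSigmaPair (σ : ℚ_[p]⟦X⟧) (c : ℚ_[p]) : Prop where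
  /-- `σ(0) = 0`. -/
  constantCoeff_eq : constantCoeff σ = 0
  /-- `σ = t + O(t²)`. -/
  coeff_one_eq : coeff 1 σ = 1
  /-- `σ ∈ ℤ_p⟦t⟧`. -/
  norm_coeff_le : ∀ n, ‖coeff n σ‖ ≤ 1
  /-- `c ∈ ℤ_p`. -/
  norm_const_le : ‖c‖ ≤ 1
  /-- `σ` is odd: `σ(i(t)) = -σ(t)`. -/
  odd : W.IsFormallyOdd σ
  /-- `x(t) + c = -(d/ω)((1/σ)(dσ/ω))`. -/
  ode : W.SatisfiesSigmaODE σ c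

/-- The Mazur–Tate pair `(σ_p, c)` of `W/ℚ_p`, by choice among the pairs satisfying
`IsMazurTateSigmaPair` (unique under `mazur_tate_sigma_existsUnique`); junk `(t, 0)` if there is
none. [Mazur–Stein–Tate 2006, Thm. 1.3] [cite: MazurSteinTate2006, Thm. 1.3] -/
def mazurTatePair : ℚ_[p]⟦X⟧ × ℚ_[p] :=
  if h : ∃ σc : ℚ_[p]⟦X⟧ × ℚ_[p], W.IsMazurTateSigmaPair σc.1 σc.2 then h.choose else (X, 0)

/-- **The canonical `p`-adic sigma function** `σ_p(t) = t + (a₁/2)t² + ⋯ ∈ tℤ_p⟦t⟧` of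
`(E, ω)`. [Mazur–Tate 1991, Thm. 3.1; Mazur–Stein–Tate 2006, Thm. 1.3] [cite: MazurSteinTate2006, Thm. 1.3] -/
def padicSigma : ℚ_[p]⟦X⟧ :=
  W.mazurTatePair.1

/-- The Mazur–Tate constant `c ∈ ℤ_p` of the sigma ODE. [Mazur–Stein–Tate 2006, Thm. 1.3] [cite: MazurSteinTate2006, Thm. 1.3] -/
def padicSigmaConst : ℚ_[p] :=
  W.mazurTatePair.2

/-- **`E₂(E, ω) ∈ ℚ_p` for `W/ℚ_p`**, defined through the Mazur–Tate constant:
`E₂(E, ω) = a₁² + 4a₂ - 12c` (MST 2006, §1: `c = (a₁² + 4a₂)/12 - E₂(E, ω)/12`, with `E₂` Katz's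
`p`-adic weight-2 Eisenstein value via the unit-root splitting). Junk `0` when no Mazur–Tate pair
exists (e.g. outside the good ordinary case). [Mazur–Stein–Tate 2006, §1 (eq. for `c`);
Katz 1973, App. 2] [cite: MazurSteinTate2006, §1.1] -/
def padicE2Local : ℚ_[p] :=
  if ∃ σc : ℚ_[p]⟦X⟧ × ℚ_[p], W.IsMazurTateSigmaPair σc.1 σc.2 then
    W.a₁ ^ 2 + 4 * W.a₂ - 12 * W.padicSigmaConst
  else 0

end Padic

/-- **`E₂(E, ω)_p`** for a Weierstrass curve over `ℚ` (intended: globally minimal, `p ≥ 5` of good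
ordinary reduction; `ω = dx/(2y + a₁x + a₃)` of `W`): `padicE2Local` of `W ⊗ ℚ_p`.
[Mazur–Stein–Tate 2006, §1; Katz 1973, App. 2] [cite: MazurSteinTate2006, §1.1] -/
def padicE2 (W : WeierstrassCurve ℚ) (p : ℕ) [Fact p.Prime] : ℚ_[p] :=
  (W.baseChange ℚ_[p]).padicE2Local

/-! ### Named fact (nothing asserted) -/

/-- **Mazur–Stein–Tate 2006, Thm. 1.3 (Mazur–Tate 1991).** For an elliptic curve over `ℚ` given
by a globally minimal Weierstrass equation `W` and a prime `p ≥ 5` of good ordinary reduction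
(`p ∤ a_p`), there is EXACTLY ONE pair `(σ, c)`, `σ = t + ⋯ ∈ tℤ_p⟦t⟧` odd, `c ∈ ℤ_p`, satisfying
`x(t) + c = -(d/ω)((1/σ)(dσ/ω))` for `W ⊗ ℚ_p`. [Mazur–Stein–Tate 2006, Thm. 1.3;
Mazur–Tate 1991, Thm. 3.1] [cite: MazurSteinTate2006, Thm. 1.3] -/
def mazur_tate_sigma_existsUnique : Prop :=
  ∀ (W : WeierstrassCurve ℚ) [W.IsElliptic] [W.IsGloballyMinimal] (p : ℕ) [Fact p.Prime],
    5 ≤ p → W.HasGoodReductionAtPrime p → ¬ (p : ℤ) ∣ W.frobeniusTrace p →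
      ∃! σc : ℚ_[p]⟦X⟧ × ℚ_[p], (W.baseChange ℚ_[p]).IsMazurTateSigmaPair σc.1 σc.2

/-! ### API -/

/-- `i(0) = 0`. [Silverman AEC IV.1] [folklore] -/
@[simp] theorem constantCoeff_formalNeg : constantCoeff W.formalNeg = 0 := by
  simp [formalNeg]

/-- `i(t) = -t + O(t²)`. [Silverman AEC IV.1 (`i(T) = -T - a₁T² - ⋯`)] [folklore] -/
theorem coeff_one_formalNeg : coeff 1 W.formalNeg = -1 := by
  rw [formalNeg, map_neg, coeff_succ_X_mul, coeff_zero_eq_constantCoeff_apply,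
    constantCoeff_invOfUnit, inv_one, Units.val_one]

/-- `i(t)` is substitutable (no constant term). [folklore] -/
theorem hasSubst_formalNeg : HasSubst W.formalNeg :=
  HasSubst.of_constantCoeff_zero W.constantCoeff_formalNeg

section PadicAPI

open scoped Classical

variable {p : ℕ} [Fact p.Prime] (W : WeierstrassCurve ℚ_[p])

/-- If a Mazur–Tate pair exists, `(padicSigma, padicSigmaConst)` is one. [Mazur–Stein–Tate 2006,
Thm. 1.3] [folklore] -/
theorem isMazurTateSigmaPair_padicSigma (h : ∃ σ : ℚ_[p]⟦X⟧, ∃ c, W.IsMazurTateSigmaPair σ c) :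
    W.IsMazurTateSigmaPair W.padicSigma W.padicSigmaConst := by
  have h' : ∃ σc : ℚ_[p]⟦X⟧ × ℚ_[p], W.IsMazurTateSigmaPair σc.1 σc.2 :=
    let ⟨σ, c, hσ⟩ := h; ⟨(σ, c), hσ⟩
  simp only [padicSigma, padicSigmaConst, mazurTatePair, dif_pos h']
  exact h'.choose_spec

/-- Under uniqueness, any Mazur–Tate pair IS `(padicSigma, padicSigmaConst)`. [Mazur–Stein–Tate
2006, Thm. 1.3] [folklore] -/
theorem eq_padicSigma_of_existsUnique
    (h : ∃! σc : ℚ_[p]⟦X⟧ × ℚ_[p], W.IsMazurTateSigmaPair σc.1 σc.2) {σ : ℚ_[p]⟦X⟧} {c : ℚ_[p]}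
    (hσ : W.IsMazurTateSigmaPair σ c) : σ = W.padicSigma ∧ c = W.padicSigmaConst := by
  have hp := W.isMazurTateSigmaPair_padicSigma ⟨σ, c, hσ⟩
  have := h.unique (y₁ := (σ, c)) (y₂ := (W.padicSigma, W.padicSigmaConst)) hσ hp
  exact ⟨congrArg Prod.fst this, congrArg Prod.snd this⟩

/-- With a Mazur–Tate pair, `E₂ = a₁² + 4a₂ - 12c`. [Mazur–Stein–Tate 2006, §1] [folklore] -/
theorem padicE2Local_eq (h : ∃ σ : ℚ_[p]⟦X⟧, ∃ c, W.IsMazurTateSigmaPair σ c) :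
    W.padicE2Local = W.a₁ ^ 2 + 4 * W.a₂ - 12 * W.padicSigmaConst := by
  have h' : ∃ σc : ℚ_[p]⟦X⟧ × ℚ_[p], W.IsMazurTateSigmaPair σc.1 σc.2 :=
    let ⟨σ, c, hσ⟩ := h; ⟨(σ, c), hσ⟩
  simp [padicE2Local, h']

/-- `σ_p(0) = 0` whenever a Mazur–Tate pair exists. [Mazur–Stein–Tate 2006, Thm. 1.3] [folklore] -/
theorem constantCoeff_padicSigma (h : ∃ σ : ℚ_[p]⟦X⟧, ∃ c, W.IsMazurTateSigmaPair σ c) :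
    constantCoeff W.padicSigma = 0 :=
  (W.isMazurTateSigmaPair_padicSigma h).constantCoeff_eq

end PadicAPI

/-- Unfolding `padicE2`. [folklore] -/
theorem padicE2_def (W : WeierstrassCurve ℚ) (p : ℕ) [Fact p.Prime] :
    W.padicE2 p = (W.baseChange ℚ_[p]).padicE2Local := rfl

end WeierstrassCurve
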